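import Literature.Geometry.Riemannian.BaerHankeNormalForm
import Literature.Geometry.Riemannian.BoundaryCylinderMetric
import Literature.Geometry.Riemannian.BoundaryCylinderSliceData
import Literature.Geometry.Riemannian.BoundaryCylinderSliceDataTwo
import Literature.Geometry.Riemannian.BoundaryCylinderTransport
import Literature.Geometry.Riemannian.DeformedCylinderMetric
import Literature.Geometry.Riemannian.DeformedCylinderScalarCurvature
import Literature.Geometry.Lorentzian.LocalIsometryScalarCurvature
import Literature.Geometry.Lorentzian.CurvatureContinuity
import Literature.Topology.FourManifolds.GluingProofs
import HarnessLib

/-!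
# Bär–Hanke, Prop. 28: the mean curvature of a PSC metric can be increased — PROOF

Topic `Literature/Geometry/Riemannian`. Proof file for the named fact
`Literature.Geometry.Riemannian.BarHanke2023_prop28_meanCurvatureIncrease` of
`BaerHankeNormalForm.lean` (Bär–Hanke, *Boundary conditions for scalar curvature*, §3, Prop. 28
with its proof, arXiv:2012.09127 p. 13), which it DISCHARGES
(`BarHanke2023_prop28_meanCurvatureIncrease_holds`), following the printed proof. (The sibling
`BaerHankeNormalFormProofs.lean` serves the other fact of that file, Thm. 27.)

1. (Bär–Hanke (7)–(8).) Embed the compact piece `X` in its double `P`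
   (`exists_isBoundaryGluing_holds`) and take boundary normal coordinates of an extension `ĝ`
   of `g`: the tube map `T(z, t) = exp^{ĝ}(t · d(jM)(-ν z))`, its inverse Fermi chart `ψ`, and
   the generalized cylinder `G = T^* ĝ = g_t + dt²` on `∂X × ℝ` (`exists_boundaryCylinderMetric`),
   with `H^G_{t=0} = -H_g` (`boundaryCylinder_sliceZero_meanCurvature`).
2. ("`f^δ = g - δψ(t) g_0`", cut-off `ψ(t) = t` near `0`.) Deform the slices:
   `Γ_δ = e^{-δψ(t)} g_t + dt²` (`exists_cylDeform`, `exists_linearCutoff`); then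
   `K^{Γ_δ}_0 = K_0 - ½δ g_0` and `H^{Γ_δ}_0 = H^G_0 - ½δ dim ∂X` (`meanCurvature_cylSlice_of_val`;
   printed: `II_{f^δ} = II_g + ½δ g_0`, `H_{f^δ} = H_g + ½δ`).
3. ("for `δ → 0`, `f^δ → g` …, hence `scal_{f^δ} > σ` for small `δ`".) The scalar curvature of
   `Γ_δ` depends continuously on `(point, δ)` (`continuous_scalarCurvature_family`, through the
   suspension metric); since `scal_g ≥ s₀ > 0` on the compact `X`, a compactness argument
   (`exists_pos_param_of_continuous`) gives `δ > 0` with `scal_{Γ_δ} > s₀/2` on `∂X × [0, ε/2]`,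
   while `Γ_δ = G` for `t ≥ ε/2`.
4. ("this defines a family of smooth `(2,0)`-tensor fields on `M`".) Transport `Γ_δ` through the
   Fermi chart to a metric `ĝ'` on `P` equal to `ĝ` off the tube (`exists_transport_of_eqOn`) and
   pull it back to `X` along `jM` (`PseudoRiemannianMetric.comap`): the new metric `g'` agrees
   with `g` along `∂X` (so the boundary form and the unit normal are unchanged), has
   `H_{g'} = H_g + ½δ(m+1)` (`boundaryCylinder_sliceZero_meanCurvature_of_metric`), and positive
   scalar curvature everywhere (naturality of the scalar curvature along `jM` and `T`,
   `scalarCurvature_comap`, `scalarCurvature_eq_of_val_eq_pullbackBilin`).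

Deviation from the printed proof: the slices are deformed conformally (`e^{-δψ(t)} g_t`)
rather than additively (`g_t - δψ(t) g_0`); both have the same first-order effect at `t = 0`,
and the conformal variant is Riemannian for every `δ` and makes the parameter dependence of the
scalar curvature explicit (`DeformedCylinderScalarCurvature.lean`).

* `BarHanke2023_prop28_meanCurvatureIncrease_holds` — the discharge.

No definitions, no new named facts (D-0026).

## References

* C. Bär, B. Hanke, *Boundary conditions for scalar curvature*, in *Perspectives in Scalar
  Curvature* vol. 2, World Scientific 2023, 325–377 = arXiv:2012.09127, §3, Prop. 28 and its
  proof (p. 13); (7)–(9) (pp. 10–11). READ. [BarHanke2023]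
* B. O'Neill, *Semi-Riemannian geometry* (1983), Ch. 3, Prop. 3.59. [ONeill1983]
-/

noncomputable section

open Bundle Set Function Filter Metric
open scoped Manifold ContDiff Topology

namespace Literature.Geometry.Riemannian

open Literature.Geometry.Lorentzian Literature.Geometry.Lorentzian.PseudoRiemannianMetric
  Literature.Geometry.Manifold Literature.Topology.FourManifolds

/-! ### A compactness lemma: positivity persists for small parameters -/

/-- **Positivity persists for small parameters** (the compactness step of Bär–Hanke's proof of
Prop. 28, "for sufficiently small `δ` … `scal_{f^δ} > σ`"): if `S` is continuous on
`(N × ℝ) × ℝ` with `N` compact and `S((z, t), 0) ≥ s₀ > 0` for `t ∈ [a, b]`, then for some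
`δ ∈ (0, 1]`, `S((z, t), δ) > s₀ / 2` for all `z` and `t ∈ [a, b]` (minimise the parameter over
the compact set where `S ≤ s₀/2`). [cite: BarHanke2023, §3, proof of Prop. 28] -/
theorem exists_pos_param_of_continuous {N : Type*} [TopologicalSpace N] [CompactSpace N]
    {S : (N × ℝ) × ℝ → ℝ} (hS : Continuous S) {s₀ a b : ℝ} (hs₀ : 0 < s₀)
    (h0 : ∀ z, ∀ t ∈ Icc a b, s₀ ≤ S ((z, t), 0)) :
    ∃ δ : ℝ, 0 < δ ∧ δ ≤ 1 ∧ ∀ z, ∀ t ∈ Icc a b, s₀ / 2 < S ((z, t), δ) := by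
  set K : Set ((N × ℝ) × ℝ) := ((univ : Set N) ×ˢ Icc a b) ×ˢ Icc 0 1 with hK
  have hKc : IsCompact K := (isCompact_univ.prod isCompact_Icc).prod isCompact_Icc
  set A : Set ((N × ℝ) × ℝ) := K ∩ S ⁻¹' Iic (s₀ / 2) with hA
  have hAc : IsCompact A := hKc.inter_right (isClosed_Iic.preimage hS)
  by_cases hAne : A.Nonempty
  · obtain ⟨q₀, hq₀, hmin⟩ := hAc.exists_isMinOn hAne continuous_snd.continuousOn
    obtain ⟨⟨z₀, t₀⟩, δ₀⟩ := q₀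
    have hK₀ : (((z₀, t₀), δ₀) : (N × ℝ) × ℝ) ∈ K := hq₀.1
    have hS₀ : S ((z₀, t₀), δ₀) ≤ s₀ / 2 := hq₀.2
    have ht₀ : t₀ ∈ Icc a b := hK₀.1.2
    have hδ₀0 : 0 ≤ δ₀ := hK₀.2.1
    have hδ₀pos : 0 < δ₀ := by
      rcases hδ₀0.lt_or_eq with h | h
      · exact h
      · exfalso
        have h1 := h0 z₀ t₀ ht₀
        rw [h] at h1
        linarith
    refine ⟨δ₀ / 2, by linarith, by linarith [hK₀.2.2], fun z t ht ↦ ?_⟩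
    by_contra hle
    rw [not_lt] at hle
    have hmem : (((z, t), δ₀ / 2) : (N × ℝ) × ℝ) ∈ A :=
      ⟨⟨⟨mem_univ _, ht⟩, ⟨by linarith, by linarith [hK₀.2.2]⟩⟩, hle⟩
    have h2 : δ₀ ≤ δ₀ / 2 := hmin hmem
    linarith
  · refine ⟨1, one_pos, le_rfl, fun z t ht ↦ ?_⟩
    by_contra hle
    rw [not_lt] at hle
    exact hAne ⟨((z, t), 1), ⟨⟨mem_univ _, ht⟩, ⟨zero_le_one, le_rfl⟩⟩, hle⟩

/-! ### The discharge -/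

universe u

set_option synthInstance.maxHeartbeats 400000 in
set_option maxHeartbeats 6400000 in
/-- **Bär–Hanke 2023, Prop. 28 (`σ = 0`, point family, `s = 1`): the mean curvature of a PSC
metric on a compact manifold with boundary can be raised by a positive constant keeping the
boundary metric, the unit normal and `scal > 0`** — discharge of the named fact
`BarHanke2023_prop28_meanCurvatureIncrease`, by the printed proof (normal coordinates, deformation
of the slices `g_t` supported near the boundary with `ψ(t) = t` near `0`, `II ↦ II + ½δ g_0`,
small `δ` by continuity and compactness); see the module docstring for the dictionary with the
tree's bricks. [cite: BarHanke2023, §3, Prop. 28 and its proof (arXiv:2012.09127, p. 13)] -/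
theorem BarHanke2023_prop28_meanCurvatureIncrease_holds :
    BarHanke2023_prop28_meanCurvatureIncrease := by
  intro m X _ _ _ _ _ _ bX g _ hf ν hgR hscal hunit hνs hout
  rcases isEmpty_or_nonempty bX.carrier with hE | hNE
  · -- empty boundary: nothing to do
    exact ⟨1, one_pos, g, ‹g.HasLeviCivita›, hf, hgR, hscal, hunit, fun z ↦ rfl,
      fun z ↦ (IsEmpty.false z).elim⟩
  haveI : Fact (1 ≤ (∞ : ℕ∞ω)) := ⟨by exact_mod_cast le_top⟩
  -- Step 1: the double `P ⊇ X` and boundary normal coordinates of an extension `ĝ` of `g`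
  obtain ⟨P, _, _, _, _, _, _, hglue⟩ :=
    exists_isBoundaryGluing_holds (bM := bX) (bN := bX) (Diffeomorph.refl (𝓡 (m + 1)) bX.carrier ∞)
  obtain ⟨jM, -, hjM, -, -, -⟩ := hglue
  obtain ⟨ĝ, hĝLC, hĝR, hpull, -, ε, hε, -, hplus, hminus, hEs,
    ⟨ψ, hsrc, htgt, hsymm, hleft, hψs, -, -⟩, G, hGLC, hGR, hGcyl, hGval, hscalG⟩ :=
    exists_boundaryCylinderMetric bX hjM g hgR ν hunit hνs hout
  haveI := hĝLC
  haveI := hGLC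
  haveI h1cov : CovariantDerivative.ContMDiffCovariantDerivative ĝ.leviCivita 1 :=
    contMDiffCovariantDerivative_leviCivita_of_two_le ĝ (WithTop.coe_le_coe.2 le_top)
  haveI : CompactSpace bX.carrier := bX.compactSpace_carrier
  set I2 := (𝓡 (m + 1)).prod 𝓘(ℝ, ℝ) with hI2
  set T : bX.carrier × ℝ → P := fun q ↦ expMap ĝ.leviCivita (jM (bX.incl q.1))
    (q.2 • mfderiv (𝓡∂ (m + 2)) (𝓡 (m + 2)) jM (bX.incl q.1) (-ν q.1)) with hT
  have hEs1 : ∀ q : bX.carrier × ℝ, q.2 ∈ Ioo (-ε) ε → ContMDiffAt I2 (𝓡 (m + 2)) ∞ T q :=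
    fun q hq ↦ (hEs q hq).1
  have hEinj : ∀ q : bX.carrier × ℝ, q.2 ∈ Ioo (-ε) ε →
      Injective (mfderiv I2 (𝓡 (m + 2)) T q) := fun q hq ↦ (hEs q hq).2
  have hjMs : ContMDiff (𝓡∂ (m + 2)) (𝓡 (m + 2)) ∞ jM := hjM.contMDiff
  have hjMs1 : ContMDiff (𝓡∂ (m + 2)) (𝓡 (m + 2)) (∞ + 1) jM := hjM.contMDiff
  have hjMinj : ∀ a : X, Injective (mfderiv (𝓡∂ (m + 2)) (𝓡 (m + 2)) jM a) := fun a ↦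
    injective_mfderiv_of_isImmersionAt' (hjM.isImmersion.isImmersionAt a)
  have hT0 : ∀ z : bX.carrier, T (z, 0) = jM (bX.incl z) := fun z ↦ by
    show expMap ĝ.leviCivita (jM (bX.incl z))
      ((0 : ℝ) • mfderiv (𝓡∂ (m + 2)) (𝓡 (m + 2)) jM (bX.incl z) (-ν z)) = _
    rw [zero_smul]
    exact expMap_zero (cov := ĝ.leviCivita) _
  -- naturality of the scalar curvature along `jM` (all points, boundary included)
  have hnat : ∀ (g₂ : PseudoRiemannianMetric (𝓡 (m + 2)) ∞ (EuclideanSpace ℝ (Fin (m + 2)))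
      (TangentSpace (𝓡 (m + 2)) : P → Type _)) [g₂.HasLeviCivita]
      (gX : PseudoRiemannianMetric (𝓡∂ (m + 2)) ∞ (EuclideanSpace ℝ (Fin (m + 2)))
      (TangentSpace (𝓡∂ (m + 2)) : X → Type _)) [gX.HasLeviCivita],
      (∀ (a : X) (v w : TangentSpace (𝓡∂ (m + 2)) a),
        g₂.val (jM a) (mfderiv (𝓡∂ (m + 2)) (𝓡 (m + 2)) jM a v)
          (mfderiv (𝓡∂ (m + 2)) (𝓡 (m + 2)) jM a w) = gX.val a v w) →
      ∀ a : X, g₂.scalarCurvature (jM a) = gX.scalarCurvature a := by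
    intro g₂ _ gX _ hpull₂ a
    have hval : ∀ q ∈ (univ : Set X), gX.val q =
        pullbackBilin (I := 𝓡 (m + 2)) (I' := 𝓡∂ (m + 2)) jM g₂.val q := by
      intro q _
      refine ContinuousLinearMap.ext fun v ↦ ContinuousLinearMap.ext fun w ↦ ?_
      rw [pullbackBilin_apply, hpull₂]
    exact (scalarCurvature_eq_of_val_eq_pullbackBilin g₂ gX isOpen_univ (fun q _ ↦ hjMs q)
      (fun q _ ↦ hjMinj q) rfl hval (q := a) (mem_univ a)).symm
  -- `scal_g ≥ s₀ > 0` on the compact `X`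
  haveI : Nonempty X := ⟨bX.incl (Classical.arbitrary _)⟩
  have hcontg : Continuous g.scalarCurvature :=
    continuous_scalarCurvature_of_two_le g (by exact WithTop.coe_le_coe.2 le_top)
  obtain ⟨x₀, -, hx₀⟩ := isCompact_univ.exists_isMinOn univ_nonempty hcontg.continuousOn
  set s₀ := g.scalarCurvature x₀ with hs₀def
  have hs₀ : 0 < s₀ := hscal x₀
  have hs₀le : ∀ x, s₀ ≤ g.scalarCurvature x := fun x ↦ hx₀ (mem_univ x)
  -- Step 2: the cut-off `ψ₀` and the deformed cylinders `Γ_δ = e^{-δψ₀(t)} g_t + dt²`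
  obtain ⟨ψ₀, hψ₀s, hψ₀id, hψ₀zero⟩ := exists_linearCutoff (r := ε / 2) (by linarith)
  set φ : bX.carrier × ℝ → ℝ := fun p ↦ -ψ₀ p.2 with hφdef
  have hφs : ContMDiff I2 𝓘(ℝ, ℝ) ∞ φ := (hψ₀s.contMDiff.comp contMDiff_snd).neg
  have hφc : Continuous φ := hφs.continuous
  have hfs : ∀ δ : ℝ, ContMDiff I2 𝓘(ℝ, ℝ) ∞ (fun p : bX.carrier × ℝ ↦ Real.exp (δ * φ p)) :=
    fun δ ↦ Real.contDiff_exp.comp_contMDiff (contMDiff_const.mul hφs)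
  choose Γ hΓR hΓcyl hΓval using fun δ : ℝ ↦ exists_cylDeform G hGR hGcyl
    (fun p : bX.carrier × ℝ ↦ Real.exp (δ * φ p)) (hfs δ) (fun p ↦ Real.exp_pos _)
  haveI hΓLC : ∀ δ, (Γ δ).HasLeviCivita := fun δ ↦ (Γ δ).hasLeviCivita
  -- `Γ_δ = G` where `ψ₀ = 0`, in particular for `|t| ≥ ε/2`, and at `t = 0`
  have hψ₀0 : ψ₀ 0 = 0 := hψ₀id 0 (by rw [abs_zero]; linarith)
  have hΓG : ∀ (δ : ℝ) (q : bX.carrier × ℝ), ε / 2 ≤ |q.2| → (Γ δ).val q = G.val q :=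
    fun δ q hq ↦ val_eq_of_val_of_eq_one G (Γ δ) (fun p : bX.carrier × ℝ ↦ Real.exp (δ * φ p))
      (hΓval δ) (by simp only [hφdef, hψ₀zero q.2 hq, neg_zero, mul_zero, Real.exp_zero])
  have hΓG0 : ∀ (δ : ℝ) (z : bX.carrier), (Γ δ).val (z, 0) = G.val (z, 0) :=
    fun δ z ↦ val_eq_of_val_of_eq_one G (Γ δ) (fun p : bX.carrier × ℝ ↦ Real.exp (δ * φ p))
      (hΓval δ) (by simp only [hφdef, hψ₀0, neg_zero, mul_zero, Real.exp_zero])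
  have hΓ0 : ∀ q, (Γ 0).val q = G.val q := fun q ↦
    val_eq_of_val_of_eq_one G (Γ 0) (fun p : bX.carrier × ℝ ↦ Real.exp (0 * φ p))
      (hΓval 0) (by rw [zero_mul, Real.exp_zero])
  -- Step 3: joint continuity of `scal_{Γ_δ}` and the choice of `δ`
  obtain ⟨𝔊, h𝔊R, h𝔊cyl, h𝔊val⟩ := exists_suspension G hGR hGcyl
    (fun q : (bX.carrier × ℝ) × ℝ ↦ Real.exp (q.2 * φ q.1))
    (Real.contDiff_exp.comp_contMDiff (contMDiff_snd.mul (hφs.comp contMDiff_fst)))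
    (fun q ↦ Real.exp_pos _)
  haveI := 𝔊.hasLeviCivita
  have hcont : Continuous fun q : (bX.carrier × ℝ) × ℝ ↦ (Γ q.2).scalarCurvature q.1 :=
    continuous_scalarCurvature_family G hGcyl φ Γ hΓval 𝔊 h𝔊R h𝔊cyl h𝔊val hφc
  have hslab0 : ∀ (z : bX.carrier) (t : ℝ), t ∈ Ico 0 ε → s₀ ≤ (Γ 0).scalarCurvature (z, t) := by
    intro z t ht
    have htI : t ∈ Ioo (-ε) ε := ⟨by linarith [ht.1], ht.2⟩
    rw [scalarCurvature_congr_of_val_eq hΓ0 (z, t), hscalG z t htI]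
    -- `T(z, t) = jM a`
    obtain ⟨a, ha⟩ : ∃ a : X, T (z, t) = jM a := by
      rcases ht.1.lt_or_eq with h | h
      · obtain ⟨a, -, ha⟩ := hplus z t ⟨h, ht.2⟩
        exact ⟨a, ha.symm⟩
      · exact ⟨bX.incl z, by rw [← h]; exact hT0 z⟩
    show s₀ ≤ ĝ.scalarCurvature (T (z, t))
    rw [ha, hnat ĝ g hpull a]
    exact hs₀le a
  obtain ⟨δ, hδ, -, hSpos⟩ := exists_pos_param_of_continuous hcont hs₀
    (a := 0) (b := ε / 2) (fun z t ht ↦ hslab0 z t ⟨ht.1, by linarith [ht.2]⟩)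
  -- Step 4: transport `Γ_δ` to `P` and pull back to `X`
  obtain ⟨ĝ', hĝ'R, hΓĝ', hK₁c, hĝ'off, hĝ'T⟩ := exists_transport_of_eqOn ĝ hĝR G (Γ δ) (hΓR δ)
    (r := ε / 2) (by linarith) (by linarith) T ψ htgt hsymm hψs hEs1 hGval (hΓG δ)
  haveI := ĝ'.hasLeviCivita
  set gX := ĝ'.comap (contMDiff_pullbackBilin_holds (I := 𝓡 (m + 2)) (M := P) (I' := 𝓡∂ (m + 2))
    (N := X)) jM hjMs1 hjMinj rfl with hgX
  haveI hgXLC : gX.HasLeviCivita := gX.hasLeviCivita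
  have hpullX : ∀ (a : X) (v w : TangentSpace (𝓡∂ (m + 2)) a),
      ĝ'.val (jM a) (mfderiv (𝓡∂ (m + 2)) (𝓡 (m + 2)) jM a v)
        (mfderiv (𝓡∂ (m + 2)) (𝓡 (m + 2)) jM a w) = gX.val a v w := fun a v w ↦ rfl
  have hgXR : gX.IsRiemannian := by
    intro a v hv
    rw [← hpullX]
    exact hĝ'R (jM a) _ fun h0 ↦ hv (hjMinj a (by rw [map_zero]; exact h0))
  -- the new metric agrees with `g` along the boundary
  have hbd : ∀ (z : bX.carrier) (v w : TangentSpace (𝓡∂ (m + 2)) (bX.incl z)),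
      gX.val (bX.incl z) v w = g.val (bX.incl z) v w := by
    intro z v w
    have h0 : (0 : ℝ) ∈ Ioo (-ε) ε := ⟨by linarith, hε⟩
    have key : ĝ'.val (jM (bX.incl z)) = ĝ.val (jM (bX.incl z)) := by
      rw [← hT0 z]
      exact hĝ'T (z, 0) h0 (hΓG0 δ z)
    rw [← hpullX, key, hpull]
  have hfX : gX.IsSpacelikeImmersion (𝓡 (m + 1)) bX.incl := by
    refine ⟨hf.1, fun y v hv ↦ ?_⟩
    rw [inducedBilin_apply, hbd, ← inducedBilin_apply]
    exact hf.2 y v hv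
  have hunitX : gX.IsUnitNormal (𝓡 (m + 1)) bX.incl ν 1 :=
    ⟨fun y v ↦ by rw [hbd]; exact hunit.1 y v, fun y ↦ by rw [hbd]; exact hunit.2 y⟩
  have hpbX : ∀ z, pullbackBilin (I := 𝓡∂ (m + 2)) (I' := 𝓡 (m + 1)) bX.incl gX.val z =
      pullbackBilin (I := 𝓡∂ (m + 2)) (I' := 𝓡 (m + 1)) bX.incl g.val z := fun z ↦
    ContinuousLinearMap.ext fun v ↦ ContinuousLinearMap.ext fun w ↦ by
      rw [pullbackBilin_apply, pullbackBilin_apply, hbd]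
  -- Step 2 (continued): the mean curvature increases by `δ (m+1) / 2`
  have hψ₀' : HasDerivAt ψ₀ 1 0 := by
    refine (hasDerivAt_id (0 : ℝ)).congr_of_eventuallyEq ?_
    filter_upwards [Metric.closedBall_mem_nhds (0 : ℝ) (show (0 : ℝ) < ε / 2 / 2 by linarith)]
      with t ht
    rw [mem_closedBall, Real.dist_eq, sub_zero] at ht
    exact hψ₀id t ht
  have hHX : ∀ z, gX.meanCurvature bX.incl contMDiff_pullbackBilin_holds hfX ν z =
      g.meanCurvature bX.incl contMDiff_pullbackBilin_holds hf ν z + δ / 2 * (m + 1) := by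
    intro z
    have hH1 := boundaryCylinder_sliceZero_meanCurvature bX hjM g hf ν hνs ĝ hpull G hGR hε hEs1
      hEinj hGval z
    have hH2 := boundaryCylinder_sliceZero_meanCurvature_of_metric bX hjM gX hfX ν hνs ĝ ĝ' hpullX
      (Γ δ) (hΓR δ) hε hEs1 hEinj hΓĝ' z
    have h1 : Real.exp (δ * φ (z, 0)) = 1 := by
      simp only [hφdef, hψ₀0, neg_zero, mul_zero, Real.exp_zero]
    have hft : HasDerivAt (fun τ : ℝ ↦ Real.exp (δ * φ (z, τ))) (-δ) 0 := by
      have h := ((hψ₀'.neg).const_mul δ).exp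
      have h' : HasDerivAt (fun x : ℝ ↦ Real.exp (δ * (-ψ₀) x)) (-δ) 0 := by
        refine h.congr_deriv ?_
        rw [Pi.neg_apply, hψ₀0, neg_zero, mul_zero, Real.exp_zero]
        ring
      exact h'
    have hH3 := meanCurvature_cylSlice_of_val G (Γ δ) hGR (hΓR δ) hGcyl (hΓcyl δ)
      (fun p : bX.carrier × ℝ ↦ Real.exp (δ * φ p)) (hΓval δ) h1 hft
    rw [finrank_euclideanSpace_fin] at hH3
    rw [hH2, hH1] at hH3
    push_cast at hH3
    linarith
  -- Step 3/4 (continued): positive scalar curvature of the new metric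
  have hslab_open : IsOpen ((univ : Set bX.carrier) ×ˢ Ioo (-ε) ε) := isOpen_univ.prod isOpen_Ioo
  have hdim : Module.finrank ℝ (EuclideanSpace ℝ (Fin (m + 1)) × ℝ) =
      Module.finrank ℝ (EuclideanSpace ℝ (Fin (m + 2))) := by
    rw [Module.finrank_prod, Module.finrank_self, finrank_euclideanSpace_fin,
      finrank_euclideanSpace_fin]
  -- on the slab: `scal_{ĝ'}(T q) = scal_{Γ_δ}(q)`
  have hscalT : ∀ (z : bX.carrier) (t : ℝ), t ∈ Ioo (-ε) ε →
      (Γ δ).scalarCurvature (z, t) = ĝ'.scalarCurvature (T (z, t)) := by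
    intro z t ht
    exact scalarCurvature_eq_of_val_eq_pullbackBilin ĝ' (Γ δ) hslab_open
      (fun q hq ↦ hEs1 q hq.2) (fun q hq ↦ hEinj q hq.2) hdim
      (fun q hq ↦ hΓĝ' q.1 q.2 hq.2) (q := (z, t)) ⟨mem_univ _, ht⟩
  -- for `t > ε/2`: `scal_{Γ_δ} = scal_G`
  have hscalfar : ∀ (z : bX.carrier) (t : ℝ), ε / 2 < t →
      (Γ δ).scalarCurvature (z, t) = G.scalarCurvature (z, t) := by
    intro z t ht
    have hUo : IsOpen {q : bX.carrier × ℝ | ε / 2 < q.2} := isOpen_lt continuous_const continuous_snd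
    have h := scalarCurvature_eq_of_val_eq_pullbackBilin G (Γ δ) hUo
      (E := (id : bX.carrier × ℝ → bX.carrier × ℝ)) (fun q _ ↦ contMDiffAt_id)
      (fun q _ ↦ by rw [mfderiv_id]; exact fun v w h ↦ h) rfl
      (fun q hq ↦ by
        rw [pullbackBilin_id]
        exact hΓG δ q (by rw [abs_of_pos (by linarith [hq.out] : (0 : ℝ) < q.2)]; exact hq.out.le))
      (q := (z, t)) ht
    exact h
  -- off the tube: `ĝ' = ĝ` near `jM a`
  set K₁ : Set P := T '' ((univ : Set bX.carrier) ×ˢ Icc (-(ε / 2)) (ε / 2)) with hK₁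
  have hK₁src : K₁ ⊆ ψ.source := by
    rintro _ ⟨q, hq, rfl⟩
    rw [hsrc]
    exact ⟨q, ⟨mem_univ _, by linarith [hq.2.1], by linarith [hq.2.2]⟩, rfl⟩
  have hscaloff : ∀ p : P, p ∉ K₁ → ĝ'.scalarCurvature p = ĝ.scalarCurvature p := by
    intro p hp
    have hUo : IsOpen K₁ᶜ := hK₁c.isClosed.isOpen_compl
    exact scalarCurvature_eq_of_val_eq_pullbackBilin ĝ ĝ' hUo
      (E := (id : P → P)) (fun q _ ↦ contMDiffAt_id)
      (fun q _ ↦ by rw [mfderiv_id]; exact fun v w h ↦ h) rfl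
      (fun q hq ↦ by rw [pullbackBilin_id]; exact hĝ'off q hq) (q := p) hp
  have hscalX : ∀ a : X, 0 < gX.scalarCurvature a := by
    intro a
    rw [← hnat ĝ' gX hpullX a]
    by_cases ha : jM a ∈ ψ.source
    · -- in the tube: `jM a = T(z, t)` with `0 ≤ t < ε`
      rw [hsrc] at ha
      obtain ⟨⟨z, t⟩, ⟨-, ht⟩, hTa⟩ := ha
      have ht0 : 0 ≤ t := by
        by_contra h
        rw [not_le] at h
        exact hminus z t ⟨ht.1, h⟩ ⟨a, hTa.symm⟩
      rw [← hTa, ← hscalT z t ht]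
      by_cases ht2 : t ≤ ε / 2
      · have := hSpos z t ⟨ht0, ht2⟩
        linarith
      · rw [not_le] at ht2
        rw [hscalfar z t ht2, hscalG z t ht]
        show 0 < ĝ.scalarCurvature (T (z, t))
        rw [hTa, hnat ĝ g hpull a]
        exact hscal a
    · have haK : jM a ∉ K₁ := fun h ↦ ha (hK₁src h)
      rw [hscaloff (jM a) haK, hnat ĝ g hpull a]
      exact hscal a
  -- assemble
  refine ⟨δ / 2 * (m + 1), by positivity, gX, hgXLC, hfX, hgXR, hscalX, hunitX, hpbX, hHX⟩

end Literature.Geometry.Riemannian
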